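import Literature.NumberTheory.EllipticCurves.RibetTakahashiDefinitePrime
import Literature.NumberTheory.EllipticCurves.NonEisensteinPrimeOfSurjective
import HarnessLib

/-!
# The definite Ribet–Takahashi formula at a PRIME `N⁻ = q` and ARBITRARY `N⁺ = M` WITHOUT (ram):
# `ord_p η_f(Mq) = ord_p ξ_f(M, q) + t_f(q)` for `E[p]` irreducible (Takahashi 2001 Thm. 2.3 + Thm. 2.7)

Topic `Literature/NumberTheory/EllipticCurves`; sibling of `RibetTakahashiDefinitePrime.lean`, which
proves the case `t(q) = ord_p c_q = 0` (i.e. `ρ̄_{E,p}` RAMIFIED at `q`) from Takahashi's degree formula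
`δ · i_q = ξ · j_q`, `i_q j_q = c_q` (`takahashi2001_thm_2_3_of_coprime`) and ARS 2012 Thm. 2.1 (b). This
file removes the hypothesis `p ∤ c_q`: the missing input is Takahashi's **Theorem 2.7** — for `E[p]`
irreducible the map `Φ_q(J₀(N)) → Φ_q(E)` is zero on `p`-primary parts, i.e. `p ∤ i_q`,
`ord_p j_q = ord_p c_q = t(q)` — whence `ord_p δ = ord_p ξ + t(q)` and, with ARS,
`ord_p η_f(N) = ord_p ξ(E; M, q) + t(q)`: W. Zhang 2014 Thm. 6.4 / Pollack–Weston 2011 Thm. 6.8 at a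
prime `N⁻ = q`, `N⁺ = M` ARBITRARY (non-square-free allowed), for EVERY value of the Tamagawa exponent
`t(q)`, with no Hypothesis ♥ / CR, no surjectivity, no `p ≥ 5`, no ordinarity — only `ρ̄_{E,p}`
irreducible and `p ∤ Mq`. Requested by cell `bsd-ssimc` (seat `bsd-ssimc-lev`, want W-lev-11 = the
input «(G1♮-t) at non-square-free N⁺» of MEMO-6 (U4); answer MEMO-7 §2,
`run/shared/lean/pub/bsd-ssimc/bsd-ssimc-lev/MEMO-7.md`). ONE named fact (a COMPOSITE of two printed
theorems of the same paper, `def … : Prop`, D-0014) and its consequences; nothing about any curve is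
asserted.

## Source, as printed (S. Takahashi, J. Number Theory 90 (2001) 74–88 [Takahashi2001], `lit read
doi:10.1006/jnth.2000.2614`, pp. 78–81)

* p. 78 (§2, standing: "fix a square-free positive integer `N` and an isogeny class `𝓔` of semistable
  elliptic curves of conductor `N`", `N = DM`, `J = J₀^D(M)`, `π : J → E` optimal, `δ` with
  `π ∘ π^∨ = [δ]`): "For a prime `r ∣ N`, `π` induces the map `π_* : Φ_r(J) → Φ_r(E)` on groups of
  connected components of Néron fibers at `r`. Define integers `c_r = #Φ_r(E)`, `i_r = #image(π_*)`,
  `j_r = #coker(π_*)` … `L_r(J) = {x ∈ X_r(J) : T_n x = a_n(f) x for all n prime to N}` … `h_r = u_J(g_r, g_r)`".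
* p. 79: "Since `j_r = c_r/i_r`…" and **Theorem 2.3.** "`i_r` divides `h_r`, and `δ = (h_r/i_r) · j_r`."
  — p. 80: "The results stated so far are true for any prime `r` dividing `N`."
* p. 80: "In the case that `r` divides `M`, we have the following theorem, which appears in the proof of
  Proposition 3 of [15] (= Ribet–Takahashi 1997). **Theorem 2.7.** For `r ∣ M` and `ℓ` such that the
  `Gal(ℚ̄/ℚ)`-module `E[ℓ]` is irreducible, we have `ord_ℓ(j_r) = ord_ℓ(c_r)`; i.e., the map
  `Φ_r(J) → Φ_r(E)` restricted to the `ℓ`-primary part of `Φ_r(J)` is the `0`-map."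

The input of Thm. 2.7 at `D = 1` is that the Hecke algebra acts on `Φ_r(J₀(N))` through the
Eisenstein quotient (`T_n = σ′(n)`-type action: K. Ribet, Invent. Math. 100 (1990) Thm. 3.12 for
`J₀(qN′)`, `q ∤ N′`, `N′` an ARBITRARY positive integer, `q ≥ 5` — restated verbatim as "For a prime
number `q ≥ 5` and a positive integer `N` prime to `q`, Ribet proved the action of the Hecke algebra on
the component group of the Jacobian variety of the modular curve of level `Nq` at `q` is Eisenstein,
which means the Hecke operator `T_ℓ` acts by `ℓ + 1` when `ℓ` is a prime number not dividing the level"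
by T. Kim – H. Yoo, Pacific J. Math. 296 (2018) 341–355, abstract and §1 [`lit read arxiv:1710.06095`
p0002–p0003]; B. Edixhoven, Astérisque 196–197 (1991) 159–170 in general; C. Khare, Invent. Math. 154
(2003) proof of Prop. 3, "as 𝔪 is non-Eisenstein (see Theorem 3.12 of [Ri])" [arXiv:math/0211005
p0009 L45]) together with the Hecke-equivariance of `π_*` (`T_ℓ` acts on `Φ_r(E)` as `a_ℓ(E)`): a
non-zero `𝔽_p[𝕋]`-quotient of the image would force `a_ℓ(E) ≡ 1 + ℓ (mod p)` for all `ℓ ∤ Np`, i.e.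
`ρ̄_{E,p}^{ss} ≅ 𝟙 ⊕ χ̄_p` (Čebotarev, Brauer–Nesbitt), contradicting irreducibility.

## Rendering (the dictionary of `TakahashiDegreeFormula.lean` / `RibetTakahashiDefinitePrime.lean`)

`D = 1`, `J = J₀(N)`, `N = M r`, `r` prime, `gcd(M, r) = 1`, `M` ARBITRARY: `W` the `X₀(Mr)`-optimal
curve (a datum `P` of minimal degree among all data at level `M r` of all curves of conductor `M r` with
the same newform, `P.modularDegree = δ`), `c_r = ord_r Δ_min(W) = (W.minimalDiscriminantNorm ℤ).factorization r`
(Tate curve), `h_r = S.xi (a_n(W))_n` for every Brandt setup `S : Brandt.XiSetup M r` (Takahashi p. 84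
via Buzzard / Ribet 1990 §3 / Kohel), `i = i_r`, `j = j_r` existential with `0 < i`, `i j = c_r`,
`i ∣ h_r`, `δ i = h_r j` — EXACTLY as in `takahashi2001_thm_2_3_of_coprime` — PLUS Thm. 2.7's clause
`ord_p(j) = ord_p(c_r)` in the equivalent form `¬ p ∣ i` for every prime `p` at which
`ρ̄_{E,p}` is irreducible (`W.HasIrreducibleModPGaloisRep p`, the tree's predicate, Serre §4).
Standing hypotheses KEPT / GENERALISED exactly as the sibling did for Thm. 2.3: Takahashi prints both
theorems at square-free `N`; at ARBITRARY `M` (additive primes away from `r` allowed) Thm. 2.3 is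
refereed print BY COMPOSITION (Conrad–Stein 2001 Thm. 6.1 / Prop. 6.5 / Cor. 6.6 at `J₀(Mp)`, `M`
arbitrary + Kohel 2001 Thm. 4.3; graded by the reading desk of cell `pub/bsd-litref/bstw24`, see the
sibling's module docstring), and Thm. 2.7 is Ribet's Eisenstein theorem for `Φ_r(J₀(Mr))` (printed for
`M` arbitrary and `r ≥ 5`) + the two-line Brauer–Nesbitt argument above; accordingly the fact below
carries the extra binder `5 ≤ r` (Kim–Yoo's restatement; `r ∈ {2, 3}` is Edixhoven's case and is NOT
asserted here). Label offered to the ARM-P desk: VERBATIM-COMPOSITE (Takahashi 2.3 ∧ 2.7 at `D = 1`;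
arbitrary `M` by CS01 + Kohel01 + Ribet90 3.12).
-- TODO(general form): Takahashi's Thm. 2.7 is printed for `J₀^D(M)` with `D > 1` as well (Shimura
-- curves), and Thm. 2.3 for every `(D, M)`; only `D = 1` is in the tree's vocabulary.

## What is proved from it (all modulo the named facts `hT27` and `hARS` = ARS 2012 Thm. 2.1 (b))

`padicValNat_modularDegree_eq_xi_add_of_irreducible` (`ord_p δ = ord_p ξ_S + ord_p c_r`);
`padicValNat_congruenceNumber_eq_xi_add_of_irreducible` (`ord_p r_f = ord_p ξ_S + ord_p c_r`, `p ∤ Mr`);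
the `BrandtModuleJLSelfPairing` and the printed `… + Σ_{ℓ∣r} tamagawaExponent` shapes; and
`WZhang2014_thm64_prime_of_irreducible` / `…_of_surjective`: the conclusion of the tree's binder
`WZhang2014.thm64_padicValNat_congruenceNumber_eq` at `Nminus` PRIME `≥ 5`, `Nplus` arbitrary, for every
`p ∤ N` with `ρ̄_{E,p}` irreducible (resp. surjective, the binder's own hypothesis) — NO ♥(1)/♥(2), NO
`5 ≤ p`, NO ordinarity, ANY `t(N⁻)`. The binder itself (composite square-free `N⁻`, ♥) is NOT discharged.

## References

* [Takahashi2001] S. Takahashi, J. Number Theory 90 (2001) 74–88: §2 p. 78 (definitions), Thm. 2.3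
  (p. 79), p. 80 ("true for any prime `r` dividing `N`"), Thm. 2.7 (p. 80). READ.
* [RibetTakahashi1997] K. Ribet, S. Takahashi, PNAS 94 (1997) 11110–11114, proof of Prop. 3 (source of
  Thm. 2.7, per Takahashi).
* [Ribet1990] K. Ribet, Invent. Math. 100 (1990) 431–476, Thm. 3.12 (Eisenstein action on
  `Φ_q(J₀(Nq))`); restated in T. Kim, H. Yoo, Pacific J. Math. 296 (2018) 341–355, p. 341 (READ,
  arXiv:1710.06095); B. Edixhoven, Astérisque 196–197 (1991) 159–170; used the same way in C. Khare,
  Invent. Math. 154 (2003), proof of Prop. 3 (READ, arXiv:math/0211005 p0009).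
* [ConradStein2001] Math. Res. Lett. 8 (2001), Thm. 6.1, Prop. 6.5, Cor. 6.6, §7.1, §7.4;
  [Kohel2001] Adv. Stud. Pure Math. 30, Thm. 4.3 (the arbitrary-`M` dictionary, as in the sibling).
* [PollackWeston2011] Compos. Math. 147 (2011), Props. 6.3–6.6, Thm. 6.8 (the same identity at
  square-free `N`, where Prop. 6.4 (1) "[Khare]" plays the role of Thm. 2.7). READ (arXiv:math/0610694
  p0014–p0015).
* [WZhang2014] Camb. J. Math. 2 (2014), Thm. 6.4 (pp. 229–230): the arbitrary-level named fact
  `WZhang2014/DefiniteCongruenceNumber.lean`; its conclusion at `N⁻` prime `≥ 5` is proved here.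
* [AgasheRibetStein2012] Thm. 2.1 (b) (through `padicValNat_congruenceNumber_eq_of_not_sq_dvd`).
-/

noncomputable section

open scoped BigOperators

namespace Literature.NumberTheory.EllipticCurves

open Literature.NumberTheory.Automorphic Literature.NumberTheory.EllipticCurves.ModularForms

/-- **Takahashi 2001, Theorem 2.3 with Theorem 2.7 (case `D = 1`, `r ∥ N`, `N = M r`, `M` arbitrary,
`r ≥ 5`): `δ · i_r = h_r · j_r`, `i_r j_r = c_r`, `i_r ∣ h_r`, and `p ∤ i_r` whenever `E[p]` is
irreducible** — NAMED FACT (composite of two printed theorems), statement only. Printed (J. Number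
Theory 90): Thm. 2.3 (p. 79) "`i_r` divides `h_r`, and `δ = (h_r/i_r) · j_r`" with `i_r = #image`,
`j_r = #coker` of `Φ_r(J) → Φ_r(E)`, `c_r = #Φ_r(E) = i_r j_r` (p. 78–79); Thm. 2.7 (p. 80) "For `r ∣ M`
and `ℓ` such that the `Gal(ℚ̄/ℚ)`-module `E[ℓ]` is irreducible, we have `ord_ℓ(j_r) = ord_ℓ(c_r)`;
i.e., the map `Φ_r(J) → Φ_r(E)` restricted to the `ℓ`-primary part of `Φ_r(J)` is the `0`-map" (⟺
`ℓ ∤ i_r`). Rendered exactly as the tree's `takahashi2001_thm_2_3_of_coprime` (module docstring): `W`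
elliptic of conductor `M r`, `r` prime, `gcd(M, r) = 1`; `P` a parametrisation datum at level `M r` of
minimal degree among all data, of all curves of conductor `M r`, with the same newform (`W` optimal,
`P.modularDegree = δ`); every Brandt setup `S` of type `(M, r)` (`h_r = S.xi (a(W))`);
`c_r = ord_r Δ_min(W)`; a prime `p` with `ρ̄_{E,p}` irreducible (`W.HasIrreducibleModPGaloisRep p`).
Conclusion: `∃ i j`, `0 < i`, `¬ p ∣ i`, `i · j = ord_r Δ_min(W)`, `i ∣ S.xi (a(W))`,
`P.modularDegree · i = S.xi (a(W)) · j`. Printed at square-free `N`; at arbitrary `M`: Thm. 2.3 by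
Conrad–Stein 2001 + Kohel 2001 (as the sibling fact), Thm. 2.7 by Ribet 1990 Thm. 3.12 (Eisenstein
action on `Φ_r(J₀(Mr))`, `M` arbitrary, `r ≥ 5`) + Brauer–Nesbitt — hence the binder `5 ≤ r`.
[cite: Takahashi2001, Thm. 2.3 (p. 79) and Thm. 2.7 (p. 80), with §2 p. 78 and p. 80 ("any prime r dividing N")]
[cite: Ribet1990, Thm. 3.12] [cite: ConradStein2001, Thm. 6.1, Prop. 6.5, Cor. 6.6, §7.4]
[cite: Kohel2001, Thm. 4.3] -/
def takahashi2001_thm_2_3_2_7_of_coprime : Prop :=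
  ∀ (W : WeierstrassCurve ℚ) [W.IsElliptic] (M r : ℕ) [NeZero (M * r)],
    r.Prime → 5 ≤ r → M.Coprime r → W.conductorNorm ℤ = M * r →
    ∀ P : ModularParametrizationData W (M * r),
      (∀ (W' : WeierstrassCurve ℚ) [W'.IsElliptic], W'.conductorNorm ℤ = M * r →
          ∀ P' : ModularParametrizationData W' (M * r),
          P'.f = P.f → P.modularDegree ≤ P'.modularDegree) →
      ∀ S : Brandt.XiSetup M r, ∀ p : ℕ, p.Prime → W.HasIrreducibleModPGaloisRep p →
        ∃ i j : ℕ, 0 < i ∧ ¬ p ∣ i ∧ i * j = (W.minimalDiscriminantNorm ℤ).factorization r ∧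
          i ∣ S.xi (fun n => W.LFunction n) ∧
          P.modularDegree * i = S.xi (fun n => W.LFunction n) * j

/-- The composite fact contains the sibling's Thm. 2.3 conclusion at every prime `r ≥ 5` (drop the
clause `¬ p ∣ i`, taking any prime `p` — the existential `i, j` may depend on `p`, but the four other
clauses do not mention it). Recorded for orientation; NOT a derivation of `takahashi2001_thm_2_3_of_coprime`
(which has no `5 ≤ r`). [cite: Takahashi2001, Thm. 2.3 (p. 79)] -/
theorem takahashi2001_thm_2_3_2_7_of_coprime.exists_of_prime (h : takahashi2001_thm_2_3_2_7_of_coprime)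
    (W : WeierstrassCurve ℚ) [W.IsElliptic] (M r : ℕ) [NeZero (M * r)] (hr : r.Prime) (hr5 : 5 ≤ r)
    (hMr : M.Coprime r) (hN : W.conductorNorm ℤ = M * r) (P : ModularParametrizationData W (M * r))
    (hP : ∀ (W' : WeierstrassCurve ℚ) [W'.IsElliptic], W'.conductorNorm ℤ = M * r →
      ∀ P' : ModularParametrizationData W' (M * r), P'.f = P.f → P.modularDegree ≤ P'.modularDegree)
    (S : Brandt.XiSetup M r) {p : ℕ} (hp : p.Prime) (hirr : W.HasIrreducibleModPGaloisRep p) :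
    ∃ i j : ℕ, 0 < i ∧ i * j = (W.minimalDiscriminantNorm ℤ).factorization r ∧
      i ∣ S.xi (fun n => W.LFunction n) ∧ P.modularDegree * i = S.xi (fun n => W.LFunction n) * j := by
  obtain ⟨i, j, hi, -, hij, hdvd, hδ⟩ := h W M r hr hr5 hMr hN P hP S p hp hirr
  exact ⟨i, j, hi, hij, hdvd, hδ⟩

/-- **`ord_p δ = ord_p ξ_S(E; M, r) + ord_p c_r` when `E[p]` is irreducible** (Takahashi 2001 Thm. 2.3
+ Thm. 2.7, `D = 1`, read `p`-adically): for the `X₀(Mr)`-optimal `W` of conductor `M r` (`r ≥ 5`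
prime, `gcd(M, r) = 1`, `M` arbitrary), a minimal-degree datum `P`, any Brandt setup `S` of type
`(M, r)`, and any prime `p` at which `ρ̄_{E,p}` is irreducible: from `δ i = ξ j`, `i j = c_r`, `p ∤ i`.
PROVED modulo the named fact (`hT27`). (Pollack–Weston 2011 Prop. 6.6 at `r`, `N₂ = 1`, square-free
`N`: "`ord_𝔭 δ_f(N₁,N₂) = t_f(r) + ord_𝔭⟨g_r, g_r⟩_J`".)
[cite: Takahashi2001, Thm. 2.3 (p. 79) and Thm. 2.7 (p. 80)] [cite: PollackWeston2011, Prop. 6.6] -/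
theorem padicValNat_modularDegree_eq_xi_add_of_irreducible (hT27 : takahashi2001_thm_2_3_2_7_of_coprime)
    (W : WeierstrassCurve ℚ) [W.IsElliptic] (M r : ℕ) [NeZero (M * r)] (hr : r.Prime) (hr5 : 5 ≤ r)
    (hMr : M.Coprime r) (hN : W.conductorNorm ℤ = M * r) (P : ModularParametrizationData W (M * r))
    (hP : ∀ (W' : WeierstrassCurve ℚ) [W'.IsElliptic], W'.conductorNorm ℤ = M * r →
      ∀ P' : ModularParametrizationData W' (M * r), P'.f = P.f → P.modularDegree ≤ P'.modularDegree)
    {p : ℕ} [Fact p.Prime] (hirr : W.HasIrreducibleModPGaloisRep p) (S : Brandt.XiSetup M r) :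
    padicValNat p P.modularDegree =
      padicValNat p (S.xi fun n => W.LFunction n) +
        padicValNat p ((W.minimalDiscriminantNorm ℤ).factorization r) := by
  have hp : p.Prime := Fact.out
  obtain ⟨i, j, hi, hpi, hij, -, hδ⟩ := hT27 W M r hr hr5 hMr hN P hP S p hp hirr
  have hδ0 : P.modularDegree ≠ 0 := P.deg_pos.ne'
  have hδi : P.modularDegree * i ≠ 0 := mul_ne_zero hδ0 hi.ne'
  have hj0 : j ≠ 0 := by
    rintro rfl
    exact hδi (by rw [hδ, mul_zero])
  have hξ0 : (S.xi fun n => W.LFunction n) ≠ 0 := by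
    intro h0
    exact hδi (by rw [hδ, h0, zero_mul])
  have h := congrArg (padicValNat p) hδ
  rw [padicValNat.mul hδ0 hi.ne', padicValNat.mul hξ0 hj0, padicValNat.eq_zero_of_not_dvd hpi,
    add_zero] at h
  rw [h, ← hij, padicValNat.mul hi.ne' hj0, padicValNat.eq_zero_of_not_dvd hpi, zero_add]

/-- **`ord_p η_f(Mr) = ord_p ξ_S(E; M, r) + ord_p c_r` when `p ∤ Mr` and `E[p]` is irreducible** — the
definite Ribet–Takahashi / Pollack–Weston Thm. 6.8 / W. Zhang Thm. 6.4 identity at a PRIME `N⁻ = r ≥ 5`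
and ARBITRARY `N⁺ = M`, for EVERY value of `t(r) = ord_p c_r` (the sibling
`padicValNat_congruenceNumber_eq_xi_of_not_dvd` is the case `p ∤ c_r`): for the `X₀(Mr)`-optimal `W`,
`P` of minimal degree among ALL data at level `M r` with the same newform (`r_f = congruenceNumber P.f
= η_f(Mr)` up to a `p`-adic unit, ARS §3 / DDT §4.4), every Brandt setup `S`, every prime `p ∤ M r`
with `ρ̄_{E,p}` irreducible. PROVED modulo `hT27` and `hARS` (ARS 2012 Thm. 2.1 (b) at `p² ∤ Mr`). No
CR / ♥, no surjectivity, no `p ≥ 5`, no ordinarity.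
[cite: PollackWeston2011, Thm. 6.8 with Props. 6.3–6.7 (§6.5, case `N⁻ = r`)]
[cite: Takahashi2001, Thm. 2.3 (p. 79) and Thm. 2.7 (p. 80)] [cite: AgasheRibetStein2012, Thm. 2.1] -/
theorem padicValNat_congruenceNumber_eq_xi_add_of_irreducible
    (hT27 : takahashi2001_thm_2_3_2_7_of_coprime) (hARS : padicValNat_congruenceNumber_eq_of_not_sq_dvd)
    (W : WeierstrassCurve ℚ) [W.IsElliptic] (M r : ℕ) [NeZero (M * r)] (hr : r.Prime) (hr5 : 5 ≤ r)
    (hMr : M.Coprime r) (hN : W.conductorNorm ℤ = M * r) (P : ModularParametrizationData W (M * r))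
    (hD : ∀ (W' : WeierstrassCurve ℚ) [W'.IsElliptic] (P' : ModularParametrizationData W' (M * r)),
      P'.f = P.f → P.modularDegree ≤ P'.modularDegree)
    (p : ℕ) [Fact p.Prime] (hpN : ¬ p ∣ M * r) (hirr : W.HasIrreducibleModPGaloisRep p)
    (S : Brandt.XiSetup M r) :
    padicValNat p (congruenceNumber P.f) =
      padicValNat p (S.xi fun n => W.LFunction n) +
        padicValNat p ((W.minimalDiscriminantNorm ℤ).factorization r) := by
  have hp : p.Prime := Fact.out
  have hp2 : ¬ p ^ 2 ∣ M * r := fun h => hpN (dvd_trans (dvd_pow_self p two_ne_zero) h)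
  rw [hARS W (M * r) P hD p hp hp2]
  exact padicValNat_modularDegree_eq_xi_add_of_irreducible hT27 W M r hr hr5 hMr hN P
    (fun W' _ _ P' hP' => hD W' P' hP') hirr S

/-- **`ord_p η_f(Mr) = ord_p ξ(E; M, r) + ord_p c_r`** (`ξ = BrandtModuleJLSelfPairing W M r = brandtXi M r (a(E))`,
the value on the chosen setup — the rendering of `PollackWeston2011.thm_6_8_ellipticCurve` and of
`WZhang2014.thm64_padicValNat_congruenceNumber_eq`) for the optimal `W` of conductor `M r`, `r ≥ 5` prime,
`gcd(M, r) = 1`, `M` arbitrary, and any prime `p ∤ M r` with `ρ̄_{E,p}` irreducible; a setup exists by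
`nonempty_xiSetup_of_prime`. PROVED modulo `hT27`, `hARS`.
[cite: PollackWeston2011, Thm. 6.8 (§6.5, case `N⁻ = r`)] [cite: Takahashi2001, Thm. 2.3 (p. 79) and Thm. 2.7 (p. 80)]
[cite: AgasheRibetStein2012, Thm. 2.1] -/
theorem padicValNat_congruenceNumber_eq_brandtModuleJLSelfPairing_add_of_irreducible
    (hT27 : takahashi2001_thm_2_3_2_7_of_coprime) (hARS : padicValNat_congruenceNumber_eq_of_not_sq_dvd)
    (W : WeierstrassCurve ℚ) [W.IsElliptic] (M r : ℕ) [NeZero (M * r)] (hr : r.Prime) (hr5 : 5 ≤ r)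
    (hMr : M.Coprime r) (hN : W.conductorNorm ℤ = M * r) (P : ModularParametrizationData W (M * r))
    (hD : ∀ (W' : WeierstrassCurve ℚ) [W'.IsElliptic] (P' : ModularParametrizationData W' (M * r)),
      P'.f = P.f → P.modularDegree ≤ P'.modularDegree)
    (p : ℕ) [Fact p.Prime] (hpN : ¬ p ∣ M * r) (hirr : W.HasIrreducibleModPGaloisRep p) :
    padicValNat p (congruenceNumber P.f) =
      padicValNat p (BrandtModuleJLSelfPairing W M r) +
        padicValNat p ((W.minimalDiscriminantNorm ℤ).factorization r) := by
  have hM : 0 < M := Nat.pos_of_ne_zero (left_ne_zero_of_mul (NeZero.ne (M * r)))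
  obtain ⟨S, hS⟩ := exists_brandtModuleJLSelfPairing_eq W (nonempty_xiSetup_of_prime hM hr hMr)
  rw [hS]
  exact padicValNat_congruenceNumber_eq_xi_add_of_irreducible hT27 hARS W M r hr hr5 hMr hN P hD p hpN
    hirr S

/-- **Pollack–Weston Thm. 6.8 / W. Zhang Thm. 6.4 in their printed shape at a prime `N⁻ = r ≥ 5`,
arbitrary `N⁺ = M`, ANY `t(r)`:** `ord_p r_f = ord_p ξ(E; M, r) + Σ_{ℓ ∣ r} t_E(p; ℓ)` — the conclusion
of `WZhang2014.thm64_padicValNat_congruenceNumber_eq` (and of `PollackWeston2011_thm_6_8`) at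
`Nplus = M`, `Nminus = r` — from «`ρ̄_{E,p}` irreducible, `p ∤ Mr`» ALONE (no ♥ / CR, no surjectivity, no
`p ≥ 5`, no ordinarity — Zhang's standing Notations (v), p. 200, is not needed on this road); the sum is
the single term `tamagawaExponent W p r = ord_p(ord_r Δ_min)`. PROVED modulo `hT27`, `hARS`.
[cite: PollackWeston2011, Thm. 6.8 (§6.5, case `N⁻ = r`)] [cite: WZhang2014, Thm. 6.4 (pp. 229–230)]
[cite: Takahashi2001, Thm. 2.3 (p. 79) and Thm. 2.7 (p. 80)] [cite: AgasheRibetStein2012, Thm. 2.1] -/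
theorem padicValNat_congruenceNumber_eq_add_sum_tamagawaExponent_of_prime_of_irreducible
    (hT27 : takahashi2001_thm_2_3_2_7_of_coprime) (hARS : padicValNat_congruenceNumber_eq_of_not_sq_dvd)
    (W : WeierstrassCurve ℚ) [W.IsElliptic] (M r : ℕ) [NeZero (M * r)] (hr : r.Prime) (hr5 : 5 ≤ r)
    (hMr : M.Coprime r) (hN : W.conductorNorm ℤ = M * r) (P : ModularParametrizationData W (M * r))
    (hD : ∀ (W' : WeierstrassCurve ℚ) [W'.IsElliptic] (P' : ModularParametrizationData W' (M * r)),
      P'.f = P.f → P.modularDegree ≤ P'.modularDegree)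
    (p : ℕ) [Fact p.Prime] (hpN : ¬ p ∣ M * r) (hirr : W.HasIrreducibleModPGaloisRep p) :
    padicValNat p (congruenceNumber P.f) =
      padicValNat p (BrandtModuleJLSelfPairing W M r) + ∑ ℓ ∈ r.primeFactors, tamagawaExponent W p ℓ := by
  have hp : p.Prime := Fact.out
  rw [Nat.Prime.primeFactors hr, Finset.sum_singleton, tamagawaExponent_eq_factorization W hp hr,
    Nat.factorization_def _ hp]
  exact padicValNat_congruenceNumber_eq_brandtModuleJLSelfPairing_add_of_irreducible hT27 hARS W M r hr
    hr5 hMr hN P hD p hpN hirr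

/-- **W. Zhang 2014 Thm. 6.4 / Pollack–Weston 2011 Thm. 6.8 at a PRIME `N⁻ ≥ 5`, in the `∀`-shape of the
tree's binder `WZhang2014.thm64_padicValNat_congruenceNumber_eq`, from «`ρ̄_{E,p}` irreducible» alone** —
for every elliptic `W/ℚ` of conductor `N⁺N⁻` with `N⁻` PRIME, `5 ≤ N⁻`, `gcd(N⁺, N⁻) = 1` (`N⁺`
arbitrary), every prime `p ∤ N⁺N⁻` with `ρ̄_{E,p}` irreducible, and every datum `D` of minimal degree
among all data at level `N⁺N⁻` with the same newform:
`ord_p r_{D.f} = ord_p ξ(E; N⁺, N⁻) + Σ_{ℓ ∣ N⁻} t_E(p; ℓ)` — WHATEVER the value of `t(N⁻)`. Compared with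
the binder: NO `5 ≤ p`, NO surjectivity, NO ♥(1), NO ♥(2), no ordinarity; compared with the sibling
`WZhang2014_thm64_prime_of_not_dvd`: NO `p ∤ ord_{N⁻} Δ_min` (in exchange: `E[p]` irreducible, `N⁻ ≥ 5`).
PROVED modulo `hT27`, `hARS`; the binder itself (composite square-free `N⁻`, ♥) is NOT discharged.
[cite: WZhang2014, Thm. 6.4 (pp. 229–230), case `ν(N⁻) = 1`] [cite: PollackWeston2011, Thm. 6.8 (§6.5, case `N⁻ = r`)]
[cite: Takahashi2001, Thm. 2.3 (p. 79) and Thm. 2.7 (p. 80)] [cite: AgasheRibetStein2012, Thm. 2.1] -/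
theorem WZhang2014_thm64_prime_of_irreducible (hT27 : takahashi2001_thm_2_3_2_7_of_coprime)
    (hARS : padicValNat_congruenceNumber_eq_of_not_sq_dvd) :
    ∀ (W : WeierstrassCurve ℚ) [W.IsElliptic] (Nplus Nminus : ℕ) [NeZero (Nplus * Nminus)],
      W.conductorNorm ℤ = Nplus * Nminus → Nat.Coprime Nplus Nminus → Nminus.Prime → 5 ≤ Nminus →
      ∀ p : ℕ, p.Prime → ¬ p ∣ Nplus * Nminus → W.HasIrreducibleModPGaloisRep p →
        ∀ D : ModularParametrizationData W (Nplus * Nminus),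
          (∀ (W' : WeierstrassCurve ℚ) [W'.IsElliptic]
              (D' : ModularParametrizationData W' (Nplus * Nminus)),
              D'.f = D.f → D.modularDegree ≤ D'.modularDegree) →
          padicValNat p (congruenceNumber D.f) =
            padicValNat p (BrandtModuleJLSelfPairing W Nplus Nminus) +
              ∑ ℓ ∈ Nminus.primeFactors, tamagawaExponent W p ℓ := by
  intro W _ Nplus Nminus _ hN hcop hq hq5 p hp hpN hirr D hD
  haveI : Fact p.Prime := ⟨hp⟩
  exact padicValNat_congruenceNumber_eq_add_sum_tamagawaExponent_of_prime_of_irreducible hT27 hARS W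
    Nplus Nminus hq hq5 hcop hN D hD p hpN hirr

/-- **The same under the binder's own image hypothesis** (`ρ̄_{E,p}` SURJECTIVE ⇒ irreducible,
`hasIrreducibleModPGaloisRep_of_hasSurjectiveModNGaloisRep`): W. Zhang Thm. 6.4 at a prime `N⁻ ≥ 5`,
arbitrary `N⁺`, every `p ∤ N` with `ρ̄_{E,p}` onto, any `t(N⁻)` — i.e. the binder
`WZhang2014.thm64_padicValNat_congruenceNumber_eq` with `Squarefree Nminus ∧ Odd #primeFactors`
specialised to `Nminus` prime `≥ 5` and its hypotheses `5 ≤ p`, ♥(1), ♥(2) DROPPED. PROVED modulo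
`hT27`, `hARS`. [cite: WZhang2014, Thm. 6.4 (pp. 229–230), case `ν(N⁻) = 1`]
[cite: Takahashi2001, Thm. 2.3 (p. 79) and Thm. 2.7 (p. 80)] [cite: AgasheRibetStein2012, Thm. 2.1] -/
theorem WZhang2014_thm64_prime_of_surjective (hT27 : takahashi2001_thm_2_3_2_7_of_coprime)
    (hARS : padicValNat_congruenceNumber_eq_of_not_sq_dvd)
    (W : WeierstrassCurve ℚ) [W.IsElliptic] (Nplus Nminus : ℕ) [NeZero (Nplus * Nminus)]
    (hN : W.conductorNorm ℤ = Nplus * Nminus) (hcop : Nat.Coprime Nplus Nminus) (hq : Nminus.Prime)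
    (hq5 : 5 ≤ Nminus) (p : ℕ) [Fact p.Prime] (hpN : ¬ p ∣ Nplus * Nminus)
    (hsurj : W.HasSurjectiveModNGaloisRep (p : ℤ)) (D : ModularParametrizationData W (Nplus * Nminus))
    (hD : ∀ (W' : WeierstrassCurve ℚ) [W'.IsElliptic] (D' : ModularParametrizationData W' (Nplus * Nminus)),
      D'.f = D.f → D.modularDegree ≤ D'.modularDegree) :
    padicValNat p (congruenceNumber D.f) =
      padicValNat p (BrandtModuleJLSelfPairing W Nplus Nminus) +
        ∑ ℓ ∈ Nminus.primeFactors, tamagawaExponent W p ℓ := by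
  have hp : p.Prime := Fact.out
  haveI : NeZero (p : ℚ) := ⟨by exact_mod_cast hp.ne_zero⟩
  exact WZhang2014_thm64_prime_of_irreducible hT27 hARS W Nplus Nminus hN hcop hq hq5 p hp hpN
    (hasIrreducibleModPGaloisRep_of_hasSurjectiveModNGaloisRep W p hsurj) D hD

end Literature.NumberTheory.EllipticCurves

end
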